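import Summits.QuantumFields.YangMills.Theorems.BalabanUVNodesN15BackgroundTupleCalculus
import Summits.QuantumFields.YangMills.Theorems.BalabanUVNodesN15VectorPieceV1Coarse
import Summits.QuantumFields.YangMills.Theorems.BalabanUVNodesN15BackgroundPropagator
import HarnessLib

/-!
# LATTICE TAYLOR FOR BACKGROUND COEFFICIENTS THROUGH KING's BOND PAIRING: block oscillation, the coarse gradient of the block mean, and the two-grid
# derivative fit FROM sup bounds on the fine first and second difference quotients (dag-n15-c g8, FILE 10; Track-A node N15 = NE2, s1)

`--kind proof --supports stmt-QuantumFields-20544 --as helper` (K3⁷; count-neutral).  THEOREMS ONLY (0 `def`).  Imports BY NAME this seat's FILE 1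
`…N15BackgroundTupleCalculus` (`fgrad`, `fgrad_apply`) and g4 `…N15VectorPieceV1Coarse` (through it: `VectorPiece.fibre_conn_kingPrV` (step-connected fibres),
`bshiftEquiv_pow_apply`, `kingPrV_bshiftEquiv_pow` (block-translation law), `BackgroundLayer.blockAvgV_translate` ∕ `blockAvgV_sub'` ∕ `norm_powSymm_sub_le` ∕
`norm_powSymm_sub_nsmul_le` (telescoping), `MatrixSpecies.blockAvgV`, `T4EtaRateCoeffDefect.blockAvg` ∕ `FibreOsc` ∕ `fit_blockAvg`) and dag-n15-b's
`…N15BackgroundPropagator` (`abs_blockAvg_le`).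

WHAT.  For a fine 1-form coefficient `f` on `T′ × {directions}` (`T′` the torus of spacing `L^{−m−k}`, `n′ = L^mL^k`), King's pairing `π = kingPrV` onto spacing `L^{−k}`
(`n = L^k`), fine∕coarse bond shifts `τ′_κ`∕`τ_κ` (`bshiftEquiv`), and the block mean `f̄ = blockAvg π f`:
* `fibreOsc_of_fgrad`: `|∇′_κf| ≤ r (∀κ) ⟹ FibreOsc π f (2(d+1)(L^m−1)·r∕n′)` (step-connected fibres);
* `fgrad_blockAvg_eq`: `∇_μf̄(x) = n·blockAvg π (f∘(τ′_μ)^{L^m} − f)(x)` (block-translation law) and ★ `abs_fgrad_blockAvg_le`: `|∇′_μf| ≤ r ⟹ |∇_μf̄| ≤ r`;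
* ★★ `abs_derivFit_le`: `|∇′_κ∇′_μf| ≤ r₂ (∀κ) ⟹ |∇′_μf(x′ − e′_μ) − ∇_μf̄(πx′ − e_μ)| ≤ (2(d+1)(L^m−1)∕n′ + 1∕n)·r₂ ≤ (2d+3)·r₂∕n` (second-order telescoping along the
  `μ`-orbit + the fibre oscillation of the translated fine quotient).
These are the lattice-Taylor facts that turn FILE 7a's displayed (3.35)–(3.36) FIT clauses into consequences of sup letters on `f`, `∇′f`, `∇′∇′f` (FILE 11).

HONEST FRAMING.  Elementary finite-difference calculus on the torus family of record; nothing about propagators; nothing continuum ∕ OS ∕ mass-gap ∕ Clay.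
-/

noncomputable section

open scoped BigOperators
open Finset

namespace Summit.QuantumFields.YangMills.BalabanUVNodes.N15.BackgroundLayer

open Literature.MathematicalPhysics.QuantumFieldTheory.Balaban1983to89
open Literature.MathematicalPhysics.QuantumFieldTheory.Balaban1983to89.T4EtaRateCoeffDefect (pull pull_apply fibre mem_fibre FibreOsc blockAvg fit_blockAvg)
open Literature.MathematicalPhysics.QuantumFieldTheory.Balaban1983to89.B5Prop11Plancherel (Tor fine unitVec)
open Summit.QuantumFields.YangMills.BalabanUVNodes.N15.MatrixSpecies (blockAvgV)
open Summit.QuantumFields.YangMills.BalabanUVNodes.N15.VectorPiece (kingPrV kingPrV_eq bshiftEquiv bshiftEquiv_apply bshiftEquiv_symm_apply bshiftEquiv_pow_apply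
  kingPrV_bshiftEquiv_pow fibre_conn_kingPrV)

variable {d : ℕ}

/-! ## §1 Abstract block-mean facts (real values) -/

section BlockMean

variable {X X' : Type} [Fintype X'] [DecidableEq X]

/-- the `E`-valued block mean at `E = ℝ` IS `T4EtaRateCoeffDefect.blockAvg`. [folklore] -/
theorem blockAvgV_eq_blockAvg (π : X' → X) (a : X' → ℝ) (x : X) : blockAvgV π a x = blockAvg π a x := by
  rw [blockAvgV, blockAvg, smul_eq_mul, ← div_eq_inv_mul]

/-- the block mean of a difference. [folklore] -/
theorem blockAvg_sub (π : X' → X) (a b : X' → ℝ) (x : X) : blockAvg π (fun x' => a x' - b x') x = blockAvg π a x - blockAvg π b x := by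
  rw [← blockAvgV_eq_blockAvg, ← blockAvgV_eq_blockAvg, ← blockAvgV_eq_blockAvg, blockAvgV_sub']

/-- the block mean of a sum. [folklore] -/
theorem blockAvg_add (π : X' → X) (a b : X' → ℝ) (x : X) : blockAvg π (fun x' => a x' + b x') x = blockAvg π a x + blockAvg π b x := by
  have h := blockAvg_sub π (fun x' => a x' + b x') b x
  have h2 : blockAvg π (fun x' => (a x' + b x') - b x') x = blockAvg π a x := by simp only [add_sub_cancel_right]
  linarith

/-- the block mean is homogeneous. [folklore] -/
theorem blockAvg_mul (π : X' → X) (c : ℝ) (a : X' → ℝ) (x : X) : blockAvg π (fun x' => c * a x') x = c * blockAvg π a x := by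
  unfold blockAvg
  rw [← Finset.mul_sum, mul_div_assoc]

/-- THE BLOCK-TRANSLATION LAW for `blockAvg`: `f̄(σ⁻¹y) = blockAvg (f∘T⁻¹)(y)` when `π∘T = σ∘π` (g4 `blockAvgV_translate` at `E = ℝ`). [folklore] -/
theorem blockAvg_translate (π : X' → X) (T : X' ≃ X') (σ : X ≃ X) (hblk : ∀ x', π (T x') = σ (π x')) (a : X' → ℝ) (y : X) :
    blockAvg π a (σ.symm y) = blockAvg π (fun x' => a (T.symm x')) y := by
  rw [← blockAvgV_eq_blockAvg, ← blockAvgV_eq_blockAvg, blockAvgV_translate π T σ hblk]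

omit [Fintype X'] [DecidableEq X] in
/-- one step of a difference quotient bounded by `r` moves the function by `≤ r∕n`. [folklore] -/
theorem abs_sub_le_of_fgrad {n r : ℝ} (hn : 0 < n) (e : X' ≃ X') {f : X' → ℝ} (h : ∀ z, |fgrad n e f z| ≤ r) (z : X') : |f (e z) - f z| ≤ r / n := by
  have h1 := h z
  rw [fgrad_apply, abs_mul, abs_of_pos hn] at h1
  rw [le_div_iff₀ hn, mul_comm]
  exact h1

omit [Fintype X'] [DecidableEq X] in
/-- the same read one step back: `|f(e⁻¹z) − f z| ≤ r∕n`. [folklore] -/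
theorem abs_sub_symm_le_of_fgrad {n r : ℝ} (hn : 0 < n) (e : X' ≃ X') {f : X' → ℝ} (h : ∀ z, |fgrad n e f z| ≤ r) (z : X') : |f (e.symm z) - f z| ≤ r / n := by
  have h1 := abs_sub_le_of_fgrad hn e h (e.symm z)
  rw [Equiv.apply_symm_apply] at h1
  rwa [abs_sub_comm]

end BlockMean

/-! ## §2 On the torus family of record: block oscillation and the coarse gradient of the block mean -/

section Torus

variable (L k m : ℕ) [NeZero L] (M : Fin (d + 1) → ℕ) [∀ μ, NeZero (M μ)]

/-- ★ **BLOCK OSCILLATION FROM THE FINE GRADIENT**: if every fine difference quotient of `f` is `≤ r` (`|∇′_κf| ≤ r`, all directions `κ`, quotient parameter `n′ > 0`),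
then `f` oscillates on each fibre of King's bond pairing by at most `2(d+1)(L^m − 1)·r∕n′` (g4 `fibre_conn_kingPrV`: the fibres are step-connected boxes of side `L^m`).
[cite: King1986, p.664 (pairing convention «x′ ∈ B^n(x)»)] -/
theorem fibreOsc_of_fgrad {n' r : ℝ} (hn' : 0 < n') {f : Tor (fine (L ^ m * L ^ k) M) × Fin (d + 1) → ℝ}
    (h : ∀ κ z, |fgrad n' (bshiftEquiv M (L ^ m * L ^ k) κ) f z| ≤ r) :
    FibreOsc (kingPrV L k m M) f (fun _ => (2 * ((d + 1) * (L ^ m - 1)) : ℕ) * (r / n')) := by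
  intro x₁ x₂ hx
  have hc := fibre_conn_kingPrV L k m M f (r / n') (fun κ i => by rw [Real.norm_eq_abs]; exact abs_sub_le_of_fgrad hn' _ (h κ) i) x₁ x₂ hx
  rwa [Real.norm_eq_abs] at hc

/-- THE COARSE GRADIENT OF THE BLOCK MEAN IS THE BLOCK MEAN OF THE `L^m`-STEP DIFFERENCE: `∇_μf̄(x) = n·(blockAvg π f (x + e_μ) − f̄(x))` with
`f̄(x) = blockAvg π (f∘((τ′_μ)^{L^m})⁻¹)(x + e_μ)` (block-translation law `π∘(τ′_μ)^{L^m} = τ_μ∘π`, g4 `kingPrV_bshiftEquiv_pow`). [cite: King1986, p.664 (pairing convention)] -/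
theorem fgrad_blockAvg_eq (n : ℝ) (μ : Fin (d + 1)) (f : Tor (fine (L ^ m * L ^ k) M) × Fin (d + 1) → ℝ) (x : Tor (fine (L ^ k) M) × Fin (d + 1)) :
    fgrad n (bshiftEquiv M (L ^ k) μ) (blockAvg (kingPrV L k m M) f) x =
      n * blockAvg (kingPrV L k m M) (fun z => f z - f ((bshiftEquiv M (L ^ m * L ^ k) μ ^ L ^ m).symm z)) (bshiftEquiv M (L ^ k) μ x) := by
  rw [fgrad_apply, blockAvg_sub]
  congr 2
  rw [← blockAvg_translate (kingPrV L k m M) (bshiftEquiv M (L ^ m * L ^ k) μ ^ L ^ m) (bshiftEquiv M (L ^ k) μ)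
    (fun x' => kingPrV_bshiftEquiv_pow L k m M μ x') f, Equiv.symm_apply_apply]

/-- ★ **THE COARSE GRADIENT OF THE BLOCK MEAN FROM THE FINE GRADIENT**: `|∇′_μf| ≤ r ⟹ |∇_μf̄| ≤ r` (`n′ = L^m·n`: the `L^m` fine steps telescoped, g4
`norm_powSymm_sub_le`, then averaged). [folklore] -/
theorem abs_fgrad_blockAvg_le {r : ℝ} (hr : 0 ≤ r) (μ : Fin (d + 1)) {f : Tor (fine (L ^ m * L ^ k) M) × Fin (d + 1) → ℝ}
    (h : ∀ z, |fgrad ((L ^ m * L ^ k : ℕ) : ℝ) (bshiftEquiv M (L ^ m * L ^ k) μ) f z| ≤ r) (x : Tor (fine (L ^ k) M) × Fin (d + 1)) :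
    |fgrad ((L ^ k : ℕ) : ℝ) (bshiftEquiv M (L ^ k) μ) (blockAvg (kingPrV L k m M) f) x| ≤ r := by
  have hL0 : 0 < L := Nat.pos_of_ne_zero (NeZero.ne L)
  have hn' : (0 : ℝ) < ((L ^ m * L ^ k : ℕ) : ℝ) := by positivity
  have hn : (0 : ℝ) ≤ ((L ^ k : ℕ) : ℝ) := by positivity
  -- per-step and telescoped bounds
  have hstep : ∀ z, ‖f ((bshiftEquiv M (L ^ m * L ^ k) μ).symm z) - f z‖ ≤ r / ((L ^ m * L ^ k : ℕ) : ℝ) := fun z => by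
    rw [Real.norm_eq_abs]; exact abs_sub_symm_le_of_fgrad hn' _ h z
  have htel : ∀ z, |f z - f ((bshiftEquiv M (L ^ m * L ^ k) μ ^ L ^ m).symm z)| ≤ (L ^ m : ℕ) * (r / ((L ^ m * L ^ k : ℕ) : ℝ)) := fun z => by
    have h1 := norm_powSymm_sub_le (bshiftEquiv M (L ^ m * L ^ k) μ) hstep (L ^ m) z
    rwa [Real.norm_eq_abs, abs_sub_comm] at h1
  have hcr : 0 ≤ (L ^ m : ℕ) * (r / ((L ^ m * L ^ k : ℕ) : ℝ)) := by positivity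
  rw [fgrad_blockAvg_eq, abs_mul, abs_of_nonneg hn]
  calc ((L ^ k : ℕ) : ℝ) * |blockAvg (kingPrV L k m M) (fun z => f z - f ((bshiftEquiv M (L ^ m * L ^ k) μ ^ L ^ m).symm z)) (bshiftEquiv M (L ^ k) μ x)|
      ≤ ((L ^ k : ℕ) : ℝ) * ((L ^ m : ℕ) * (r / ((L ^ m * L ^ k : ℕ) : ℝ))) := mul_le_mul_of_nonneg_left (abs_blockAvg_le _ hcr htel _) hn
    _ = r := by field_simp; push_cast; ring

/-- the coarse one-step oscillation of the block mean: `|f̄(x) − f̄(x − e_μ)| ≤ r∕n`. [folklore] -/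
theorem abs_blockAvg_sub_symm_le {r : ℝ} (hr : 0 ≤ r) (μ : Fin (d + 1)) {f : Tor (fine (L ^ m * L ^ k) M) × Fin (d + 1) → ℝ}
    (h : ∀ z, |fgrad ((L ^ m * L ^ k : ℕ) : ℝ) (bshiftEquiv M (L ^ m * L ^ k) μ) f z| ≤ r) (x : Tor (fine (L ^ k) M) × Fin (d + 1)) :
    |blockAvg (kingPrV L k m M) f x - blockAvg (kingPrV L k m M) f ((bshiftEquiv M (L ^ k) μ).symm x)| ≤ r / ((L ^ k : ℕ) : ℝ) := by
  have hL0 : 0 < L := Nat.pos_of_ne_zero (NeZero.ne L)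
  have hn : (0 : ℝ) < ((L ^ k : ℕ) : ℝ) := by positivity
  have h1 := abs_sub_symm_le_of_fgrad hn (bshiftEquiv M (L ^ k) μ) (abs_fgrad_blockAvg_le L k m M hr μ h) x
  rwa [abs_sub_comm] at h1

end Torus

/-! ## §3 The two-grid derivative fit from the second difference quotients -/

section DerivFit

variable (L k m : ℕ) [NeZero L] (M : Fin (d + 1) → ℕ) [∀ μ, NeZero (M μ)]

omit [NeZero L] [∀ μ, NeZero (M μ)] in
/-- bond shifts commute (translations of the torus). [folklore] -/
theorem bshiftEquiv_symm_comm {n : ℕ} (μ κ : Fin (d + 1)) (z : Tor (fine n M) × Fin (d + 1)) :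
    (bshiftEquiv M n μ).symm (bshiftEquiv M n κ z) = bshiftEquiv M n κ ((bshiftEquiv M n μ).symm z) := by
  rw [bshiftEquiv_symm_apply, bshiftEquiv_apply, bshiftEquiv_apply, bshiftEquiv_symm_apply]
  exact Prod.ext (add_sub_right_comm _ _ _) rfl

omit [NeZero L] [∀ μ, NeZero (M μ)] in
/-- the fine quotient read one step back, `g̃(z) = ∇′_μf((τ′_μ)⁻¹z) = n′·(f z − f((τ′_μ)⁻¹z))` (the backward quotient). [folklore] -/
theorem fgrad_symm_apply {n : ℕ} (n' : ℝ) (μ : Fin (d + 1)) (f : Tor (fine n M) × Fin (d + 1) → ℝ) (z : Tor (fine n M) × Fin (d + 1)) :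
    fgrad n' (bshiftEquiv M n μ) f ((bshiftEquiv M n μ).symm z) = n' * (f z - f ((bshiftEquiv M n μ).symm z)) := by
  rw [fgrad_apply, Equiv.apply_symm_apply]

omit [∀ μ, NeZero (M μ)] in
/-- THE SECOND DIFFERENCE ALONG THE `μ`-ORBIT from the second quotient: `|(f z − f(z − e′)) − (f(z − e′) − f(z − 2e′))| ≤ r₂∕n′²`. [folklore] -/
theorem abs_secondDiff_le {r₂ : ℝ} (μ : Fin (d + 1)) {f : Tor (fine (L ^ m * L ^ k) M) × Fin (d + 1) → ℝ}
    (h2 : ∀ z, |fgrad ((L ^ m * L ^ k : ℕ) : ℝ) (bshiftEquiv M (L ^ m * L ^ k) μ) (fgrad ((L ^ m * L ^ k : ℕ) : ℝ) (bshiftEquiv M (L ^ m * L ^ k) μ) f) z| ≤ r₂)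
    (z : Tor (fine (L ^ m * L ^ k) M) × Fin (d + 1)) :
    ‖(f z - f ((bshiftEquiv M (L ^ m * L ^ k) μ).symm z)) -
        (f ((bshiftEquiv M (L ^ m * L ^ k) μ).symm z) - f ((bshiftEquiv M (L ^ m * L ^ k) μ).symm ((bshiftEquiv M (L ^ m * L ^ k) μ).symm z)))‖ ≤
      r₂ / ((((L ^ m * L ^ k : ℕ) : ℝ)) * ((L ^ m * L ^ k : ℕ) : ℝ)) := by
  have hL0 : 0 < L := Nat.pos_of_ne_zero (NeZero.ne L)
  have hnf0 : (0 : ℝ) < ((L ^ m * L ^ k : ℕ) : ℝ) := by positivity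
  have h1 := h2 ((bshiftEquiv M (L ^ m * L ^ k) μ).symm ((bshiftEquiv M (L ^ m * L ^ k) μ).symm z))
  rw [fgrad_apply, fgrad_apply, fgrad_apply, Equiv.apply_symm_apply, Equiv.apply_symm_apply, ← mul_sub, ← mul_assoc, abs_mul,
    abs_of_pos (mul_pos hnf0 hnf0)] at h1
  rw [Real.norm_eq_abs, le_div_iff₀ (mul_pos hnf0 hnf0), mul_comm]
  exact h1

omit [∀ μ, NeZero (M μ)] in
/-- THE SECOND-ORDER TELESCOPING REMAINDER: `|(f z − f(z − L^m e′)) − L^m·(f z − f(z − e′))| ≤ L^{2m}·r₂∕n′²` (g4 `norm_powSymm_sub_nsmul_le`). [folklore] -/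
theorem abs_telescope_remainder_le {r₂ : ℝ} (hr₂ : 0 ≤ r₂) (μ : Fin (d + 1)) {f : Tor (fine (L ^ m * L ^ k) M) × Fin (d + 1) → ℝ}
    (h2 : ∀ z, |fgrad ((L ^ m * L ^ k : ℕ) : ℝ) (bshiftEquiv M (L ^ m * L ^ k) μ) (fgrad ((L ^ m * L ^ k : ℕ) : ℝ) (bshiftEquiv M (L ^ m * L ^ k) μ) f) z| ≤ r₂)
    (z : Tor (fine (L ^ m * L ^ k) M) × Fin (d + 1)) :
    |(f z - f ((bshiftEquiv M (L ^ m * L ^ k) μ ^ L ^ m).symm z)) - (L ^ m : ℕ) * (f z - f ((bshiftEquiv M (L ^ m * L ^ k) μ).symm z))| ≤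
      (L ^ m : ℕ) * (L ^ m : ℕ) * (r₂ / ((((L ^ m * L ^ k : ℕ) : ℝ)) * ((L ^ m * L ^ k : ℕ) : ℝ))) := by
  have hL0 : 0 < L := Nat.pos_of_ne_zero (NeZero.ne L)
  have hβ : 0 ≤ r₂ / ((((L ^ m * L ^ k : ℕ) : ℝ)) * ((L ^ m * L ^ k : ℕ) : ℝ)) := by positivity
  have h1 := norm_powSymm_sub_nsmul_le (bshiftEquiv M (L ^ m * L ^ k) μ) hβ (abs_secondDiff_le L k m M μ h2) (L ^ m) z
  rwa [Real.norm_eq_abs, smul_eq_mul] at h1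

/-- THE COARSE QUOTIENT OF THE BLOCK MEAN, DECOMPOSED: `∇_μf̄(πx′ − e_μ) = blockAvg_{πx′}(g̃) + n·blockAvg_{πx′}(telescoping remainder)` with the backward fine
quotient `g̃(z) = ∇′_μf(z − e′_μ)` (block-translation law + `n·L^m = n′`). [folklore] -/
theorem fgrad_blockAvg_symm_eq (μ : Fin (d + 1)) (f : Tor (fine (L ^ m * L ^ k) M) × Fin (d + 1) → ℝ) (x' : Tor (fine (L ^ m * L ^ k) M) × Fin (d + 1)) :
    fgrad ((L ^ k : ℕ) : ℝ) (bshiftEquiv M (L ^ k) μ) (blockAvg (kingPrV L k m M) f) ((bshiftEquiv M (L ^ k) μ).symm (kingPrV L k m M x')) =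
      blockAvg (kingPrV L k m M) (fun z => fgrad ((L ^ m * L ^ k : ℕ) : ℝ) (bshiftEquiv M (L ^ m * L ^ k) μ) f ((bshiftEquiv M (L ^ m * L ^ k) μ).symm z))
          (kingPrV L k m M x') +
        ((L ^ k : ℕ) : ℝ) * blockAvg (kingPrV L k m M)
          (fun z => (f z - f ((bshiftEquiv M (L ^ m * L ^ k) μ ^ L ^ m).symm z)) - (L ^ m : ℕ) * (f z - f ((bshiftEquiv M (L ^ m * L ^ k) μ).symm z)))
          (kingPrV L k m M x') := by
  rw [fgrad_blockAvg_eq L k m M _ μ f, Equiv.apply_symm_apply]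
  have hsplit : (fun z => f z - f ((bshiftEquiv M (L ^ m * L ^ k) μ ^ L ^ m).symm z)) =
      fun z => (L ^ m : ℕ) * (f z - f ((bshiftEquiv M (L ^ m * L ^ k) μ).symm z)) +
        ((f z - f ((bshiftEquiv M (L ^ m * L ^ k) μ ^ L ^ m).symm z)) - (L ^ m : ℕ) * (f z - f ((bshiftEquiv M (L ^ m * L ^ k) μ).symm z))) := by
    funext z; ring
  rw [hsplit, blockAvg_add, mul_add, ← blockAvg_mul]
  congr 2
  funext z
  rw [fgrad_symm_apply]
  push_cast
  ring

/-- ★★ **THE TWO-GRID DERIVATIVE FIT FROM THE SECOND DIFFERENCE QUOTIENTS.**  If `|∇′_κ∇′_μf| ≤ r₂` for every direction `κ` (second quotients at `n′ = L^mL^k`),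
then the fine quotient one step back fits the coarse quotient of the block mean one step back:
`|∇′_μf(x′ − e′_μ) − ∇_μf̄(πx′ − e_μ)| ≤ (2(d+1)(L^m − 1)∕n′ + 1∕n)·r₂` (`n = L^k`).  Mechanism: `fgrad_blockAvg_symm_eq` (the coarse quotient is the block mean of the
backward fine quotient `g̃ = ∇′_μf∘τ′⁻¹` up to `n`·(second-order telescoping remainder `≤ L^{2m}r₂∕n′²`) = `r₂∕n`), and `g̃` oscillates on the fibre of `πx′ ∋ x′` by
`≤ 2(d+1)(L^m−1)·r₂∕n′` (`fibreOsc_of_fgrad`: its fine quotients are translated mixed second quotients, shifts commute).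
[cite: Balaban1985BackgroundPropagators, (3.36) p.396 (the second-difference regularity letter: shape)] -/
theorem abs_derivFit_le {r₂ : ℝ} (hr₂ : 0 ≤ r₂) (μ : Fin (d + 1)) {f : Tor (fine (L ^ m * L ^ k) M) × Fin (d + 1) → ℝ}
    (h2 : ∀ κ z, |fgrad ((L ^ m * L ^ k : ℕ) : ℝ) (bshiftEquiv M (L ^ m * L ^ k) κ)
      (fgrad ((L ^ m * L ^ k : ℕ) : ℝ) (bshiftEquiv M (L ^ m * L ^ k) μ) f) z| ≤ r₂) (x' : Tor (fine (L ^ m * L ^ k) M) × Fin (d + 1)) :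
    |fgrad ((L ^ m * L ^ k : ℕ) : ℝ) (bshiftEquiv M (L ^ m * L ^ k) μ) f ((bshiftEquiv M (L ^ m * L ^ k) μ).symm x') -
        fgrad ((L ^ k : ℕ) : ℝ) (bshiftEquiv M (L ^ k) μ) (blockAvg (kingPrV L k m M) f) ((bshiftEquiv M (L ^ k) μ).symm (kingPrV L k m M x'))| ≤
      ((((2 * ((d + 1) * (L ^ m - 1)) : ℕ) : ℝ)) / ((L ^ m * L ^ k : ℕ) : ℝ) + 1 / ((L ^ k : ℕ) : ℝ)) * r₂ := by
  have hL0 : 0 < L := Nat.pos_of_ne_zero (NeZero.ne L)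
  have hnf0 : (0 : ℝ) < ((L ^ m * L ^ k : ℕ) : ℝ) := by positivity
  have hnc0 : (0 : ℝ) < ((L ^ k : ℕ) : ℝ) := by positivity
  -- (a) the backward fine quotient oscillates little on fibres: its fine quotients are translated mixed second quotients
  have hgstep : ∀ κ z, |fgrad ((L ^ m * L ^ k : ℕ) : ℝ) (bshiftEquiv M (L ^ m * L ^ k) κ)
      (fun z => fgrad ((L ^ m * L ^ k : ℕ) : ℝ) (bshiftEquiv M (L ^ m * L ^ k) μ) f ((bshiftEquiv M (L ^ m * L ^ k) μ).symm z)) z| ≤ r₂ := fun κ z => by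
    have h1 := h2 κ ((bshiftEquiv M (L ^ m * L ^ k) μ).symm z)
    rw [fgrad_apply] at h1 ⊢
    rw [bshiftEquiv_symm_comm M μ κ z]
    exact h1
  have hfit := fit_blockAvg (kingPrV L k m M) (fibreOsc_of_fgrad L k m M hnf0 hgstep) x'
  -- (b) the telescoping remainder, averaged
  have hrem := abs_blockAvg_le (kingPrV L k m M) (by positivity) (abs_telescope_remainder_le L k m M hr₂ μ (h2 μ)) (kingPrV L k m M x')
  -- (c) assemble
  rw [fgrad_blockAvg_symm_eq L k m M μ f x']
  calc _ ≤ |fgrad ((L ^ m * L ^ k : ℕ) : ℝ) (bshiftEquiv M (L ^ m * L ^ k) μ) f ((bshiftEquiv M (L ^ m * L ^ k) μ).symm x') -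
          blockAvg (kingPrV L k m M) (fun z => fgrad ((L ^ m * L ^ k : ℕ) : ℝ) (bshiftEquiv M (L ^ m * L ^ k) μ) f ((bshiftEquiv M (L ^ m * L ^ k) μ).symm z))
            (kingPrV L k m M x')| +
        |((L ^ k : ℕ) : ℝ) * blockAvg (kingPrV L k m M)
          (fun z => (f z - f ((bshiftEquiv M (L ^ m * L ^ k) μ ^ L ^ m).symm z)) - (L ^ m : ℕ) * (f z - f ((bshiftEquiv M (L ^ m * L ^ k) μ).symm z)))
          (kingPrV L k m M x')| := by
        rw [sub_add_eq_sub_sub]; exact abs_sub _ _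
    _ ≤ ((2 * ((d + 1) * (L ^ m - 1)) : ℕ) : ℝ) * (r₂ / ((L ^ m * L ^ k : ℕ) : ℝ)) +
        ((L ^ k : ℕ) : ℝ) * ((L ^ m : ℕ) * (L ^ m : ℕ) * (r₂ / ((((L ^ m * L ^ k : ℕ) : ℝ)) * ((L ^ m * L ^ k : ℕ) : ℝ)))) := by
        refine add_le_add hfit ?_
        rw [abs_mul, abs_of_pos hnc0]
        exact mul_le_mul_of_nonneg_left hrem hnc0.le
    _ = _ := by
        field_simp
        push_cast
        ring

/-- The same fit with the crude uniform constant `(2d + 3)·r₂∕n` (`L^m − 1 ≤ L^m`, `n′ = L^m·n`). [folklore] -/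
theorem abs_derivFit_le' {r₂ : ℝ} (hr₂ : 0 ≤ r₂) (μ : Fin (d + 1)) {f : Tor (fine (L ^ m * L ^ k) M) × Fin (d + 1) → ℝ}
    (h2 : ∀ κ z, |fgrad ((L ^ m * L ^ k : ℕ) : ℝ) (bshiftEquiv M (L ^ m * L ^ k) κ)
      (fgrad ((L ^ m * L ^ k : ℕ) : ℝ) (bshiftEquiv M (L ^ m * L ^ k) μ) f) z| ≤ r₂) (x' : Tor (fine (L ^ m * L ^ k) M) × Fin (d + 1)) :
    |fgrad ((L ^ m * L ^ k : ℕ) : ℝ) (bshiftEquiv M (L ^ m * L ^ k) μ) f ((bshiftEquiv M (L ^ m * L ^ k) μ).symm x') -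
        fgrad ((L ^ k : ℕ) : ℝ) (bshiftEquiv M (L ^ k) μ) (blockAvg (kingPrV L k m M) f) ((bshiftEquiv M (L ^ k) μ).symm (kingPrV L k m M x'))| ≤
      (2 * (d : ℝ) + 3) * r₂ / ((L ^ k : ℕ) : ℝ) := by
  have hL0 : 0 < L := Nat.pos_of_ne_zero (NeZero.ne L)
  have hnc0 : (0 : ℝ) < ((L ^ k : ℕ) : ℝ) := by positivity
  have hLm1 : (1 : ℝ) ≤ ((L ^ m : ℕ) : ℝ) := by exact_mod_cast Nat.one_le_pow _ _ hL0
  refine (abs_derivFit_le L k m M hr₂ μ h2 x').trans ?_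
  have hsub : (((2 * ((d + 1) * (L ^ m - 1)) : ℕ) : ℝ)) ≤ 2 * ((d : ℝ) + 1) * ((L ^ m : ℕ) : ℝ) := by
    have h1 : ((L ^ m - 1 : ℕ) : ℝ) ≤ ((L ^ m : ℕ) : ℝ) := by exact_mod_cast Nat.sub_le _ _
    have hd : (0 : ℝ) ≤ d := Nat.cast_nonneg d
    push_cast at h1 ⊢
    nlinarith
  have hnfc : ((L ^ m * L ^ k : ℕ) : ℝ) = ((L ^ m : ℕ) : ℝ) * ((L ^ k : ℕ) : ℝ) := by push_cast; ring
  have hA : (((2 * ((d + 1) * (L ^ m - 1)) : ℕ) : ℝ)) / ((L ^ m * L ^ k : ℕ) : ℝ) ≤ 2 * ((d : ℝ) + 1) / ((L ^ k : ℕ) : ℝ) := by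
    calc (((2 * ((d + 1) * (L ^ m - 1)) : ℕ) : ℝ)) / ((L ^ m * L ^ k : ℕ) : ℝ)
        ≤ 2 * ((d : ℝ) + 1) * ((L ^ m : ℕ) : ℝ) / ((L ^ m * L ^ k : ℕ) : ℝ) := by gcongr
      _ = 2 * ((d : ℝ) + 1) / ((L ^ k : ℕ) : ℝ) := by
          rw [hnfc]
          field_simp
  calc ((((2 * ((d + 1) * (L ^ m - 1)) : ℕ) : ℝ)) / ((L ^ m * L ^ k : ℕ) : ℝ) + 1 / ((L ^ k : ℕ) : ℝ)) * r₂
      ≤ (2 * ((d : ℝ) + 1) / ((L ^ k : ℕ) : ℝ) + 1 / ((L ^ k : ℕ) : ℝ)) * r₂ := by gcongr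
    _ = (2 * (d : ℝ) + 3) * r₂ / ((L ^ k : ℕ) : ℝ) := by ring

end DerivFit

end Summit.QuantumFields.YangMills.BalabanUVNodes.N15.BackgroundLayer

end
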